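import Summits.HubbardSuperconductivity.HubbardSuperconductivity.Theorems.WeakCouplingBCSKlLindhardEnclosureCellIntIterated
import Summits.HubbardSuperconductivity.HubbardSuperconductivity.Theorems.WeakCouplingBCSKlLindhardEnclosureSliceRegularity

/-!
# KL-MARGIN-SCAN reader (22) «kernel-lindhard-enclosure» — the POINT-RECORD GUARDS hold for every admissible `P`; CORNER enclosures of the band difference

Located item «CORNER-RECORD-OVERSHOOT» (p1 g25, `HOME/p1/g25/CORNER-MEAN-DESIGN.md` §ADDENDUM) RESOLVED WITHOUT A SIDE CONDITION.  The two
square-cell rules (`ceilChord`, `floorInside`) read the band difference `g` at the four CORNERS of a cell through the UNCLAMPED point records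
`Params.mkX/mkY` (integer Taylor floors `T₇`, `T₉` and ceilings `T₈`, `T₁₀` of `cos (z/U)` and `cos ((z+qᵢ)/U)`); the band enclosure
`…CellSound.band_enclosure` applies at a corner as soon as those four records satisfy the antitonicity GUARD `0 < 2 + 4t′c/D`, which holds
whenever `|c| < (10/9)·D` (`|t′| ≤ 9/20`).  PROVED HERE for every admissible `P` and every grid point of the root square: the records obey
`|c| ≤ (26/25)·D + 1` — the Taylor overshoot `|T_M(x) − cos x| ≤ x^{2M+2}/(2M+2)!` is `≤ 1/25` for `M ∈ {8, 9, 10}` on the admissible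
range `|x| ≤ 2·piLoZ/U ≤ 6.3`, and for the order-7 floor it is `≤ 1/25` on `|x| ≤ 11/2` while on `11/2 ≤ |x| ≤ 6.3` it is `≤ 3/10` but
there `cos x ≥ 0`, so `T₇ ≥ −3/10` — the overshoot is large only where the cosine is positive.  Consequences: `mkX_guards`/`mkY_guards`, the
corner band enclosures `corner_band_mem` / `corner_band_shift_mem`, the band difference `Params.gfun k` of kind `k` with
`gCornerLo/2^40 ≤ g(corner) ≤ gCornerUp/2^40` (`gCornerLo_le`, `le_gCornerUp`), and `gfun k (pt x y) = ± bandDiffFn t′ q₁ q₂ x y`.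
Honest framing: elementary real analysis about the landed kernel; nothing in this file asserts a KL margin at any `t′ ≠ 0`, `K₃`, `U₀`, the
window or B1g dominance; a Kohn–Luttinger instability statement is not ODLRO and nothing here proves superconductivity in the Hubbard model.
(p1 g26, 2026-08-29.)
-/

noncomputable section

set_option linter.dupNamespace false

namespace Summit.HubbardSuperconductivity.HubbardSuperconductivity.Theorems.KlLindhardEnclosure

open Real Set MeasureTheory Literature.MathematicalPhysics.QuantumLattice
open Summit.HubbardSuperconductivity.HubbardSuperconductivity.Theorems
open Summit.HubbardSuperconductivity.HubbardSuperconductivity.Theorems.FSPoly (cosTaylorQ cast_cosTaylorQ)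

/-! ## §1 Taylor overshoot of the cosine polynomials -/

/-- The recursion of `cosTaylorQ`, cast to `ℝ`. -/
theorem cast_cosTaylorQ_succ (M : ℕ) (x : ℚ) :
    ((cosTaylorQ (M + 1) x : ℚ) : ℝ) =
      ((cosTaylorQ M x : ℚ) : ℝ) + (-1 : ℝ) ^ (M + 1) * (x : ℝ) ^ (2 * (M + 1)) / ((2 * (M + 1)).factorial : ℝ) := by
  rw [cosTaylorQ]; push_cast; ring

/-- `T_M(x) ≤ cos x` for odd `M` (cast form). -/
theorem cosTaylorQ_le_cos_of_odd {M : ℕ} (hM : Odd M) (x : ℚ) : ((cosTaylorQ M x : ℚ) : ℝ) ≤ Real.cos (x : ℝ) := by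
  rw [cast_cosTaylorQ]; exact Literature.Computability.MetaComplexity.cosTaylorSum_le_cos hM _

/-- `cos x ≤ T_M(x)` for even `M` (cast form). -/
theorem cos_le_cosTaylorQ_of_even {M : ℕ} (hM : Even M) (x : ℚ) : Real.cos (x : ℝ) ≤ ((cosTaylorQ M x : ℚ) : ℝ) := by
  rw [cast_cosTaylorQ]; exact Literature.Computability.MetaComplexity.cos_le_cosTaylorSum hM _

/-- Odd order: the Taylor MINORANT undershoots by at most the next term, `cos x − T_M(x) ≤ x^{2M+2}/(2M+2)!`. -/
theorem cos_sub_cosTaylorQ_le {M : ℕ} (hM : Odd M) (x : ℚ) :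
    Real.cos (x : ℝ) - ((cosTaylorQ M x : ℚ) : ℝ) ≤ (x : ℝ) ^ (2 * (M + 1)) / ((2 * (M + 1)).factorial : ℝ) := by
  have h := cos_le_cosTaylorQ_of_even (Odd.add_one hM) x
  rw [cast_cosTaylorQ_succ, (Odd.add_one hM).neg_one_pow, one_mul] at h
  linarith

/-- Even order: the Taylor MAJORANT overshoots by at most the next term, `T_M(x) − cos x ≤ x^{2M+2}/(2M+2)!`. -/
theorem cosTaylorQ_sub_cos_le {M : ℕ} (hM : Even M) (x : ℚ) :
    ((cosTaylorQ M x : ℚ) : ℝ) - Real.cos (x : ℝ) ≤ (x : ℝ) ^ (2 * (M + 1)) / ((2 * (M + 1)).factorial : ℝ) := by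
  have h := cosTaylorQ_le_cos_of_odd (Even.add_one hM) x
  rw [cast_cosTaylorQ_succ, (Even.add_one hM).neg_one_pow] at h
  have e : ((cosTaylorQ M x : ℚ) : ℝ) + (-1 : ℝ) * (x : ℝ) ^ (2 * (M + 1)) / ((2 * (M + 1)).factorial : ℝ)
      = ((cosTaylorQ M x : ℚ) : ℝ) - (x : ℝ) ^ (2 * (M + 1)) / ((2 * (M + 1)).factorial : ℝ) := by ring
  rw [e] at h
  linarith

/-- An even power is controlled by the power of a bound on the absolute value. -/
theorem pow_even_le_of_abs_le {x r : ℝ} (n : ℕ) (h : |x| ≤ r) : x ^ (2 * n) ≤ r ^ (2 * n) := by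
  rw [← (even_two_mul n).pow_abs]
  exact pow_le_pow_left₀ (abs_nonneg x) h _

/-- `x¹⁶/16! ≤ 1/25` for `|x| ≤ 11/2`. -/
theorem pow16_small {x : ℝ} (h : |x| ≤ 11 / 2) : x ^ (2 * (7 + 1)) / ((2 * (7 + 1)).factorial : ℝ) ≤ 1 / 25 := by
  have := pow_even_le_of_abs_le (7 + 1) h
  rw [div_le_iff₀ (by positivity)]
  refine this.trans ?_
  simp only [Nat.factorial]; push_cast; norm_num

/-- `x¹⁶/16! ≤ 3/10` for `|x| ≤ 63/10`. -/
theorem pow16_large {x : ℝ} (h : |x| ≤ 63 / 10) : x ^ (2 * (7 + 1)) / ((2 * (7 + 1)).factorial : ℝ) ≤ 3 / 10 := by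
  have := pow_even_le_of_abs_le (7 + 1) h
  rw [div_le_iff₀ (by positivity)]
  refine this.trans ?_
  simp only [Nat.factorial]; push_cast; norm_num

/-- `x¹⁸/18! ≤ 1/25` for `|x| ≤ 63/10`. -/
theorem pow18_small {x : ℝ} (h : |x| ≤ 63 / 10) : x ^ (2 * (8 + 1)) / ((2 * (8 + 1)).factorial : ℝ) ≤ 1 / 25 := by
  have := pow_even_le_of_abs_le (8 + 1) h
  rw [div_le_iff₀ (by positivity)]
  refine this.trans ?_
  simp only [Nat.factorial]; push_cast; norm_num

/-- `x²⁰/20! ≤ 1/25` for `|x| ≤ 63/10`. -/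
theorem pow20_small {x : ℝ} (h : |x| ≤ 63 / 10) : x ^ (2 * (9 + 1)) / ((2 * (9 + 1)).factorial : ℝ) ≤ 1 / 25 := by
  have := pow_even_le_of_abs_le (9 + 1) h
  rw [div_le_iff₀ (by positivity)]
  refine this.trans ?_
  simp only [Nat.factorial]; push_cast; norm_num

/-- `x²²/22! ≤ 1/25` for `|x| ≤ 63/10`. -/
theorem pow22_small {x : ℝ} (h : |x| ≤ 63 / 10) : x ^ (2 * (10 + 1)) / ((2 * (10 + 1)).factorial : ℝ) ≤ 1 / 25 := by
  have := pow_even_le_of_abs_le (10 + 1) h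
  rw [div_le_iff₀ (by positivity)]
  refine this.trans ?_
  simp only [Nat.factorial]; push_cast; norm_num

/-- `cos x ≥ 0` for `11/2 ≤ |x| ≤ 63/10` (the window `[3π/2, 2π]` up to sign). -/
theorem cos_nonneg_of_large {x : ℝ} (h1 : 11 / 2 ≤ |x|) (h2 : |x| ≤ 63 / 10) : 0 ≤ Real.cos x := by
  have hpi1 := Real.pi_gt_d2
  have hpi2 := Real.pi_lt_d2
  have key : 0 ≤ Real.cos |x| := by
    rw [← Real.cos_sub_two_pi]
    exact Real.cos_nonneg_of_neg_pi_div_two_le_of_le (by linarith) (by linarith)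
  rcases le_total 0 x with hx | hx
  · rwa [abs_of_nonneg hx] at key
  · rwa [abs_of_nonpos hx, Real.cos_neg] at key

/-- **THE ORDER-7 FLOOR IS NEVER FAR BELOW `−1`**: `−26/25 ≤ T₇(x)` for `|x| ≤ 63/10` (overshoot `≤ 1/25` on `|x| ≤ 11/2`; beyond,
`cos x ≥ 0` absorbs the overshoot `≤ 3/10`). -/
theorem cosTaylorQ_seven_ge {x : ℚ} (h : |(x : ℝ)| ≤ 63 / 10) : -(26 / 25 : ℝ) ≤ ((cosTaylorQ 7 x : ℚ) : ℝ) := by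
  have hd := cos_sub_cosTaylorQ_le (M := 7) (by decide) x
  have hc := Real.neg_one_le_cos (x : ℝ)
  by_cases hs : |(x : ℝ)| ≤ 11 / 2
  · have := pow16_small hs; linarith
  · push Not at hs
    have := pow16_large h
    have := cos_nonneg_of_large hs.le h
    linarith

/-- `T₈(x) ≤ 26/25` for `|x| ≤ 63/10`. -/
theorem cosTaylorQ_eight_le {x : ℚ} (h : |(x : ℝ)| ≤ 63 / 10) : ((cosTaylorQ 8 x : ℚ) : ℝ) ≤ 26 / 25 := by
  have hd := cosTaylorQ_sub_cos_le (M := 8) (by decide) x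
  have hc := Real.cos_le_one (x : ℝ)
  have := pow18_small h; linarith

/-- `−26/25 ≤ T₉(x)` for `|x| ≤ 63/10`. -/
theorem cosTaylorQ_nine_ge {x : ℚ} (h : |(x : ℝ)| ≤ 63 / 10) : -(26 / 25 : ℝ) ≤ ((cosTaylorQ 9 x : ℚ) : ℝ) := by
  have hd := cos_sub_cosTaylorQ_le (M := 9) (by decide) x
  have hc := Real.neg_one_le_cos (x : ℝ)
  have := pow20_small h; linarith

/-- `T₁₀(x) ≤ 26/25` for `|x| ≤ 63/10`. -/
theorem cosTaylorQ_ten_le {x : ℚ} (h : |(x : ℝ)| ≤ 63 / 10) : ((cosTaylorQ 10 x : ℚ) : ℝ) ≤ 26 / 25 := by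
  have hd := cosTaylorQ_sub_cos_le (M := 10) (by decide) x
  have hc := Real.cos_le_one (x : ℝ)
  have := pow22_small h; linarith

/-! ## §2 The integer records: within one unit of `D · T_M` -/

/-- `a/b < fdivZ a b + 1` for a positive divisor. -/
theorem div_lt_fdivZ_add_one (a b : ℤ) (hb : 0 < b) : (a : ℚ) / (b : ℚ) < ((fdivZ a b : ℤ) : ℚ) + 1 := by
  unfold fdivZ
  rw [div_lt_iff₀ (by exact_mod_cast hb)]
  have h := Int.lt_ediv_add_one_mul_self a hb
  have h' : ((a : ℤ) : ℚ) < (((a / b + 1) * b : ℤ) : ℚ) := by exact_mod_cast h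
  push_cast at h'
  linarith

/-- `cdivZ a b − 1 < a/b` for a positive divisor. -/
theorem cdivZ_sub_one_lt_div (a b : ℤ) (hb : 0 < b) : ((cdivZ a b : ℤ) : ℚ) - 1 < (a : ℚ) / (b : ℚ) := by
  have h := Int.lt_ediv_add_one_mul_self (-a) hb
  have h' : ((-a : ℤ) : ℚ) < ((((-a) / b + 1) * b : ℤ) : ℚ) := by exact_mod_cast h
  have hb' : (0 : ℚ) < (b : ℚ) := by exact_mod_cast hb
  unfold cdivZ
  push_cast at h' ⊢
  rw [lt_div_iff₀ hb']
  linarith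

/-- `2^40 · T_M(z/U) − 1 < cosFlZ M z U ≤ 2^40 · T_M(z/U)`. -/
theorem cosFlZ_mem (M : ℕ) (z U : ℤ) (hU : 0 < U) :
    2 ^ 40 * ((cosTaylorQ M ((z : ℚ) / (U : ℚ)) : ℚ) : ℝ) - 1 < ((cosFlZ M z U : ℤ) : ℝ) ∧
    ((cosFlZ M z U : ℤ) : ℝ) ≤ 2 ^ 40 * ((cosTaylorQ M ((z : ℚ) / (U : ℚ)) : ℚ) : ℝ) := by
  have hden := cosDenZ_pos M hU
  have e : cosTaylorQ M ((z : ℚ) / (U : ℚ)) * 2 ^ 40 = ((cosTaylorZ M z U * 2 ^ 40 : ℤ) : ℚ) / ((cosDenZ M U : ℤ) : ℚ) := by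
    rw [cosTaylorQ_eq_div M z U hU.ne']; push_cast; ring
  have h1 := div_lt_fdivZ_add_one (cosTaylorZ M z U * 2 ^ 40) (cosDenZ M U) hden
  have h2 := fdivZ_le_div (cosTaylorZ M z U * 2 ^ 40) (cosDenZ M U) hden
  rw [← e] at h1 h2
  have h1' := (Rat.cast_lt (K := ℝ)).mpr h1
  have h2' := (Rat.cast_le (K := ℝ)).mpr h2
  push_cast at h1' h2'
  unfold cosFlZ
  constructor <;> linarith

/-- `2^40 · T_M(z/U) ≤ cosClZ M z U < 2^40 · T_M(z/U) + 1`. -/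
theorem cosClZ_mem (M : ℕ) (z U : ℤ) (hU : 0 < U) :
    2 ^ 40 * ((cosTaylorQ M ((z : ℚ) / (U : ℚ)) : ℚ) : ℝ) ≤ ((cosClZ M z U : ℤ) : ℝ) ∧
    ((cosClZ M z U : ℤ) : ℝ) < 2 ^ 40 * ((cosTaylorQ M ((z : ℚ) / (U : ℚ)) : ℚ) : ℝ) + 1 := by
  have hden := cosDenZ_pos M hU
  have e : cosTaylorQ M ((z : ℚ) / (U : ℚ)) * 2 ^ 40 = ((cosTaylorZ M z U * 2 ^ 40 : ℤ) : ℚ) / ((cosDenZ M U : ℤ) : ℚ) := by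
    rw [cosTaylorQ_eq_div M z U hU.ne']; push_cast; ring
  have h1 := div_le_cdivZ (cosTaylorZ M z U * 2 ^ 40) (cosDenZ M U) hden
  have h2 := cdivZ_sub_one_lt_div (cosTaylorZ M z U * 2 ^ 40) (cosDenZ M U) hden
  rw [← e] at h1 h2
  have h1' := (Rat.cast_le (K := ℝ)).mpr h1
  have h2' := (Rat.cast_lt (K := ℝ)).mpr h2
  push_cast at h1' h2'
  unfold cosClZ
  constructor <;> linarith

/-- The cast of the rational abscissa `z/U`. -/
theorem cast_div_int (z U : ℤ) : ((((z : ℚ) / (U : ℚ)) : ℚ) : ℝ) = (z : ℝ) / (U : ℝ) := by push_cast; ring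

/-- **RECORD MAGNITUDE**: for `0 < U` and `|z/U| ≤ 63/10`, the four kinds of point records all satisfy `9·|c| < 10·2^40`. -/
theorem records_small (z U : ℤ) (hU : 0 < U) (hz : |(z : ℝ) / (U : ℝ)| ≤ 63 / 10) :
    9 * |cosFlZ 7 z U| < 10 * 2 ^ 40 ∧ 9 * |cosClZ 8 z U| < 10 * 2 ^ 40 ∧
    9 * |cosFlZ 9 z U| < 10 * 2 ^ 40 ∧ 9 * |cosClZ 10 z U| < 10 * 2 ^ 40 := by
  have hz' : |((((z : ℚ) / (U : ℚ)) : ℚ) : ℝ)| ≤ 63 / 10 := by rwa [cast_div_int]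
  have c7lo := cosTaylorQ_seven_ge hz'
  have c7hi := cosTaylorQ_le_cos_of_odd (M := 7) (by decide) ((z : ℚ) / (U : ℚ))
  have c8lo := cos_le_cosTaylorQ_of_even (M := 8) (by decide) ((z : ℚ) / (U : ℚ))
  have c8hi := cosTaylorQ_eight_le hz'
  have c9lo := cosTaylorQ_nine_ge hz'
  have c9hi := cosTaylorQ_le_cos_of_odd (M := 9) (by decide) ((z : ℚ) / (U : ℚ))
  have c10lo := cos_le_cosTaylorQ_of_even (M := 10) (by decide) ((z : ℚ) / (U : ℚ))
  have c10hi := cosTaylorQ_ten_le hz'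
  have cosb1 := Real.cos_le_one ((((z : ℚ) / (U : ℚ)) : ℚ) : ℝ)
  have cosb2 := Real.neg_one_le_cos ((((z : ℚ) / (U : ℚ)) : ℚ) : ℝ)
  obtain ⟨f7a, f7b⟩ := cosFlZ_mem 7 z U hU
  obtain ⟨f8a, f8b⟩ := cosClZ_mem 8 z U hU
  obtain ⟨f9a, f9b⟩ := cosFlZ_mem 9 z U hU
  obtain ⟨f10a, f10b⟩ := cosClZ_mem 10 z U hU
  refine ⟨?_, ?_, ?_, ?_⟩
  · have h1 : |((cosFlZ 7 z U : ℤ) : ℝ)| < 10 * 2 ^ 40 / 9 := abs_lt.mpr ⟨by linarith, by linarith⟩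
    have : (9 : ℝ) * |((cosFlZ 7 z U : ℤ) : ℝ)| < 10 * 2 ^ 40 := by linarith
    exact_mod_cast this
  · have h1 : |((cosClZ 8 z U : ℤ) : ℝ)| < 10 * 2 ^ 40 / 9 := abs_lt.mpr ⟨by linarith, by linarith⟩
    have : (9 : ℝ) * |((cosClZ 8 z U : ℤ) : ℝ)| < 10 * 2 ^ 40 := by linarith
    exact_mod_cast this
  · have h1 : |((cosFlZ 9 z U : ℤ) : ℝ)| < 10 * 2 ^ 40 / 9 := abs_lt.mpr ⟨by linarith, by linarith⟩
    have : (9 : ℝ) * |((cosFlZ 9 z U : ℤ) : ℝ)| < 10 * 2 ^ 40 := by linarith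
    exact_mod_cast this
  · have h1 : |((cosClZ 10 z U : ℤ) : ℝ)| < 10 * 2 ^ 40 / 9 := abs_lt.mpr ⟨by linarith, by linarith⟩
    have : (9 : ℝ) * |((cosClZ 10 z U : ℤ) : ℝ)| < 10 * 2 ^ 40 := by linarith
    exact_mod_cast this

/-! ## §3 The guards hold at every point record of the root square -/

/-- A numerator `c` with `9·|c| < 10·2^40` passes the antitonicity guard when `|t′| ≤ 9/20`. -/
theorem Params.guard_of_small (P : Params) (htpD : 0 < P.tpD) (ht : 20 * |P.tpN| ≤ 9 * P.tpD) {c : ℤ}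
    (hc : 9 * |c| < 10 * 2 ^ 40) : P.guard c = true := by
  simp only [Params.guard, D, decide_eq_true_eq]
  have h1 : -(|P.tpN| * |c|) ≤ P.tpN * c := by rw [← abs_mul]; exact neg_abs_le _
  have h2 : 20 * (|P.tpN| * |c|) ≤ 9 * P.tpD * |c| := by nlinarith [abs_nonneg c]
  have h3 : 9 * P.tpD * (9 * |c|) ≤ 9 * P.tpD * (10 * 2 ^ 40) := by
    have : 9 * |c| ≤ 10 * 2 ^ 40 := hc.le
    nlinarith
  nlinarith

/-- Admissible ⇒ every integer `w` with `|w| ≤ 2·piLoZ` has `|w/U| ≤ 63/10`. -/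
theorem Params.abs_div_le_of_le_two_piLoZ (P : Params) (hP : P.admissible = true) {w : ℤ} (hw : |w| ≤ 2 * P.piLoZ) :
    |(w : ℝ) / (P.U : ℝ)| ≤ 63 / 10 := by
  simp only [Params.admissible, Bool.and_eq_true, decide_eq_true_eq] at hP
  have hU : 0 < P.U := hP.1.1.1.1.1.1.2
  have hpi : P.piLoZ * 1000000 ≤ 3141592 * P.U := hP.1.1.1.1.1.2
  have hU' : (0 : ℝ) < (P.U : ℝ) := by exact_mod_cast hU
  have hw' : |(w : ℝ)| ≤ 2 * (P.piLoZ : ℝ) := by exact_mod_cast hw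
  have hpi' : (P.piLoZ : ℝ) * 1000000 ≤ 3141592 * (P.U : ℝ) := by exact_mod_cast hpi
  rw [abs_div, abs_of_pos hU', div_le_iff₀ hU']
  nlinarith

/-- **ALL FOUR RECORDS OF `mkX z` ARE GUARDED** for admissible `P` and `z` in the root square (`|z| ≤ Xz`). -/
theorem Params.mkX_guards (P : Params) (hP : P.admissible = true) {z : ℤ} (hz1 : -P.Xz ≤ z) (hz2 : z ≤ P.Xz) :
    P.guard (P.mkX z).lo = true ∧ P.guard (P.mkX z).hi = true ∧ P.guard (P.mkX z).lo' = true ∧ P.guard (P.mkX z).hi' = true := by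
  obtain ⟨htpD, -, hU, hq1, -⟩ := P.admissible_facts hP
  have ht : 20 * |P.tpN| ≤ 9 * P.tpD := by
    simp only [Params.admissible, Bool.and_eq_true, decide_eq_true_eq] at hP; exact hP.1.1.1.1.1.1.1.1.2
  have hq := abs_nonneg P.q1z
  have hz : |z| ≤ 2 * P.piLoZ := by rw [abs_le]; omega
  have hz' : |z + P.q1z| ≤ 2 * P.piLoZ := by
    have h1 := le_abs_self P.q1z
    have h2 := neg_abs_le P.q1z
    rw [abs_le]; constructor <;> omega
  have r1 := records_small z P.U hU (P.abs_div_le_of_le_two_piLoZ hP hz)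
  have r2 := records_small (z + P.q1z) P.U hU (P.abs_div_le_of_le_two_piLoZ hP hz')
  exact ⟨P.guard_of_small htpD ht r1.1, P.guard_of_small htpD ht r1.2.1, P.guard_of_small htpD ht r2.2.2.1,
    P.guard_of_small htpD ht r2.2.2.2⟩

/-- **ALL FOUR RECORDS OF `mkY z` ARE GUARDED** for admissible `P` and `z` in the root square. -/
theorem Params.mkY_guards (P : Params) (hP : P.admissible = true) {z : ℤ} (hz1 : -P.Xz ≤ z) (hz2 : z ≤ P.Xz) :
    P.guard (P.mkY z).lo = true ∧ P.guard (P.mkY z).hi = true ∧ P.guard (P.mkY z).lo' = true ∧ P.guard (P.mkY z).hi' = true := by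
  obtain ⟨htpD, -, hU, -, hq2⟩ := P.admissible_facts hP
  have ht : 20 * |P.tpN| ≤ 9 * P.tpD := by
    simp only [Params.admissible, Bool.and_eq_true, decide_eq_true_eq] at hP; exact hP.1.1.1.1.1.1.1.1.2
  have hq := abs_nonneg P.q2z
  have hz : |z| ≤ 2 * P.piLoZ := by rw [abs_le]; omega
  have hz' : |z + P.q2z| ≤ 2 * P.piLoZ := by
    have h1 := le_abs_self P.q2z
    have h2 := neg_abs_le P.q2z
    rw [abs_le]; constructor <;> omega
  have r1 := records_small z P.U hU (P.abs_div_le_of_le_two_piLoZ hP hz)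
  have r2 := records_small (z + P.q2z) P.U hU (P.abs_div_le_of_le_two_piLoZ hP hz')
  exact ⟨P.guard_of_small htpD ht r1.1, P.guard_of_small htpD ht r1.2.1, P.guard_of_small htpD ht r2.2.2.1,
    P.guard_of_small htpD ht r2.2.2.2⟩

/-! ## §4 Corner enclosures of the band and of the band difference -/

/-- **CORNER BAND ENCLOSURE (unshifted)**: at the grid point `(x/U, y/U)` of the root square,
`bandDnZ hi hi / 2^40 ≤ ε(x/U, y/U) ≤ bandUpZ lo lo / 2^40` with the point records of `mkX x`, `mkY y`. -/
theorem Params.corner_band_mem (P : Params) (hP : P.admissible = true) {x y : ℤ} (hx1 : -P.Xz ≤ x) (hx2 : x ≤ P.Xz)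
    (hy1 : -P.Xz ≤ y) (hy2 : y ≤ P.Xz) :
    ((P.bandDnZ (P.mkX x).hi (P.mkY y).hi : ℤ) : ℝ) / 2 ^ 40 ≤ P.band (pt ((x : ℝ) / (P.U : ℝ)) ((y : ℝ) / (P.U : ℝ))) ∧
    P.band (pt ((x : ℝ) / (P.U : ℝ)) ((y : ℝ) / (P.U : ℝ))) ≤ ((P.bandUpZ (P.mkX x).lo (P.mkY y).lo : ℤ) : ℝ) / 2 ^ 40 := by
  obtain ⟨htpD, -, hU, -, -⟩ := P.admissible_facts hP
  obtain ⟨g1, g2, -, -⟩ := P.mkX_guards hP hx1 hx2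
  obtain ⟨g3, g4, -, -⟩ := P.mkY_guards hP hy1 hy2
  have key := P.band_enclosure htpD g1 g2 g3 g4 (P.mkX_lo_le hU x) (P.le_mkX_hi hU x) (P.mkY_lo_le hU y) (P.le_mkY_hi hU y)
  rw [P.band_apply, pt_apply_zero, pt_apply_one]
  exact key

/-- The coordinates of the shifted corner `pt (x/U) (y/U) + q`. -/
theorem Params.pt_add_qv_apply (P : Params) (x y : ℤ) :
    (pt ((x : ℝ) / (P.U : ℝ)) ((y : ℝ) / (P.U : ℝ)) + P.qv) 0 = ((x + P.q1z : ℤ) : ℝ) / (P.U : ℝ) ∧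
    (pt ((x : ℝ) / (P.U : ℝ)) ((y : ℝ) / (P.U : ℝ)) + P.qv) 1 = ((y + P.q2z : ℤ) : ℝ) / (P.U : ℝ) := by
  constructor
  · rw [PiLp.add_apply, P.qv_apply_zero, pt_apply_zero]; push_cast; ring
  · rw [PiLp.add_apply, P.qv_apply_one, pt_apply_one]; push_cast; ring

/-- **CORNER BAND ENCLOSURE (shifted)**: at `(x/U, y/U) + q`,
`bandDnZ hi' hi' / 2^40 ≤ ε ≤ bandUpZ lo' lo' / 2^40` with the primed point records of `mkX x`, `mkY y`. -/
theorem Params.corner_band_shift_mem (P : Params) (hP : P.admissible = true) {x y : ℤ} (hx1 : -P.Xz ≤ x) (hx2 : x ≤ P.Xz)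
    (hy1 : -P.Xz ≤ y) (hy2 : y ≤ P.Xz) :
    ((P.bandDnZ (P.mkX x).hi' (P.mkY y).hi' : ℤ) : ℝ) / 2 ^ 40 ≤ P.band (pt ((x : ℝ) / (P.U : ℝ)) ((y : ℝ) / (P.U : ℝ)) + P.qv) ∧
    P.band (pt ((x : ℝ) / (P.U : ℝ)) ((y : ℝ) / (P.U : ℝ)) + P.qv) ≤ ((P.bandUpZ (P.mkX x).lo' (P.mkY y).lo' : ℤ) : ℝ) / 2 ^ 40 := by
  obtain ⟨htpD, -, hU, -, -⟩ := P.admissible_facts hP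
  obtain ⟨-, -, g1, g2⟩ := P.mkX_guards hP hx1 hx2
  obtain ⟨-, -, g3, g4⟩ := P.mkY_guards hP hy1 hy2
  have key := P.band_enclosure htpD g1 g2 g3 g4 (P.mkX_lo'_le hU x) (P.le_mkX_hi' hU x) (P.mkY_lo'_le hU y) (P.le_mkY_hi' hU y)
  obtain ⟨e0, e1⟩ := P.pt_add_qv_apply x y
  rw [P.band_apply, e0, e1]
  exact key

/-- The band DIFFERENCE of kind `k` at a momentum: `g_true(p) = ε(p+q) − ε(p)` (cells where `p` is occupied and `p + q` empty),
`g_false(p) = ε(p) − ε(p+q)` (the other two-shell kind). [folklore] -/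
def Params.gfun (P : Params) (k : Bool) (p : Momentum) : ℝ :=
  if k then P.band (p + P.qv) - P.band p else P.band p - P.band (p + P.qv)

/-- **CORNER LOWER BOUND**: `gCornerLo k (mkX x) (mkY y) / 2^40 ≤ g_k(x/U, y/U)` at every grid point of the root square. -/
theorem Params.gCornerLo_le (P : Params) (hP : P.admissible = true) (k : Bool) {x y : ℤ} (hx1 : -P.Xz ≤ x) (hx2 : x ≤ P.Xz)
    (hy1 : -P.Xz ≤ y) (hy2 : y ≤ P.Xz) :
    ((P.gCornerLo k (P.mkX x) (P.mkY y) : ℤ) : ℝ) / 2 ^ 40 ≤ P.gfun k (pt ((x : ℝ) / (P.U : ℝ)) ((y : ℝ) / (P.U : ℝ))) := by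
  obtain ⟨u1, u2⟩ := P.corner_band_mem hP hx1 hx2 hy1 hy2
  obtain ⟨s1, s2⟩ := P.corner_band_shift_mem hP hx1 hx2 hy1 hy2
  cases k with
  | true =>
    simp only [Params.gCornerLo, Params.gfun, ↓reduceIte, Int.cast_sub]
    rw [sub_div]; linarith
  | false =>
    simp only [Params.gCornerLo, Params.gfun, Bool.false_eq_true, ↓reduceIte, Int.cast_sub]
    rw [sub_div]; linarith

/-- **CORNER UPPER BOUND**: `g_k(x/U, y/U) ≤ gCornerUp k (mkX x) (mkY y) / 2^40` at every grid point of the root square. -/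
theorem Params.le_gCornerUp (P : Params) (hP : P.admissible = true) (k : Bool) {x y : ℤ} (hx1 : -P.Xz ≤ x) (hx2 : x ≤ P.Xz)
    (hy1 : -P.Xz ≤ y) (hy2 : y ≤ P.Xz) :
    P.gfun k (pt ((x : ℝ) / (P.U : ℝ)) ((y : ℝ) / (P.U : ℝ))) ≤ ((P.gCornerUp k (P.mkX x) (P.mkY y) : ℤ) : ℝ) / 2 ^ 40 := by
  obtain ⟨u1, u2⟩ := P.corner_band_mem hP hx1 hx2 hy1 hy2
  obtain ⟨s1, s2⟩ := P.corner_band_shift_mem hP hx1 hx2 hy1 hy2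
  cases k with
  | true =>
    simp only [Params.gCornerUp, Params.gfun, ↓reduceIte, Int.cast_sub]
    rw [sub_div]; linarith
  | false =>
    simp only [Params.gCornerUp, Params.gfun, Bool.false_eq_true, ↓reduceIte, Int.cast_sub]
    rw [sub_div]; linarith

/-- The band difference in real coordinates is `± bandDiffFn t′ q₁ q₂` (`+` for kind `true`). -/
theorem Params.gfun_pt (P : Params) (k : Bool) (x y : ℝ) :
    P.gfun k (pt x y) = (if k then (1 : ℝ) else -1) *
      bandDiffFn ((P.tpN : ℝ) / (P.tpD : ℝ)) ((P.q1z : ℝ) / (P.U : ℝ)) ((P.q2z : ℝ) / (P.U : ℝ)) x y := by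
  have e0 : (pt x y + P.qv) 0 = x + (P.q1z : ℝ) / (P.U : ℝ) := by rw [PiLp.add_apply, P.qv_apply_zero, pt_apply_zero]
  have e1 : (pt x y + P.qv) 1 = y + (P.q2z : ℝ) / (P.U : ℝ) := by rw [PiLp.add_apply, P.qv_apply_one, pt_apply_one]
  cases k <;> simp only [Params.gfun, Bool.false_eq_true, ↓reduceIte, P.band_apply, e0, e1, pt_apply_zero, pt_apply_one,
    bandDiffFn] <;> ring

end Summit.HubbardSuperconductivity.HubbardSuperconductivity.Theorems.KlLindhardEnclosure

end
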